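import Mathlib
import Literature.NumberTheory.Automorphic.HilbertModularFormQExpansion
import Summits.Langlands.Langlands.Theorems.CapacityClassicalityHilbertIntegralOverconvergentIsCongruenceKoecher
import Summits.Langlands.Langlands.Theorems.CapacityClassicalityHilbertIntegralOverconvergentIsCongruenceKoecherPrinciple
import Summits.Langlands.Langlands.Theorems.CapacityClassicalityHilbertIntegralOverconvergentIsCongruenceStubConjPrincipalCongruence
import Summits.Langlands.Langlands.Theorems.CapacityClassicalityHilbertIntegralOverconvergentIsCongruenceStubUnitCongruenceSqFiniteIndex

/-!
# Fourier coefficients of Hilbert modular forms live on the cone (stub P1)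

Stub P1 `stub_modularForm_coeff_support` of line Sketch-ideate-r1-k1 (section P, RESHAPE 12) for the crux
`HilbertIntegralOverconvergentIsCongruence` (stmt-Langlands-8485): for `F` totally real of degree `≥ 2` and `f ∈ M_k(Γ₁(𝔫))`,
`𝔫 ≠ 0`, the Fourier coefficient `a_μ(f)` vanishes at every `μ` of the dual lattice which is neither `0` nor totally positive
(Freitag, *Hilbert Modular Forms*, Ch. I Prop. 4.9).  Proof: `f` is `𝓞 F`-periodic (translations `(1 a; 0 1) ∈ Γ₁(𝔫)`) and
satisfies `f(ε² z) = ∏_σ σ(ε)^{-k_σ} f(z)` for the units `ε ≡ 1 (mod 𝔫)` (the diagonal matrices `diag(ε, ε⁻¹) ∈ Γ₁(𝔫)`);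
the squares of these units contain a finite-index subgroup (`stub_unitCongruence_sq_finiteIndex`), so Götzky–Koecher at `∞`
(`koecher_fourierCoeff_eq_zero`) applies.
-/

set_option linter.dupNamespace false

noncomputable section

namespace Summit.Langlands.Langlands.Theorems.HilbertIntegralOverconvergentIsCongruence

open MeasureTheory Complex NumberField
open Literature.NumberTheory.Automorphic Literature.NumberTheory.Automorphic.HilbertModular
open scoped MatrixGroups

variable {F : Type} [Field F] [NumberField F]

omit [NumberField F] in
/-- The translation `(1 a; 0 1)` lies in `Γ₁(𝔫)`. -/
theorem mcs_e12_mem_Gamma1 (𝔫 : Ideal (𝓞 F)) (a : 𝓞 F) : SL2Rel.e12 a ∈ Bianchi.Gamma1 𝔫 := by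
  rw [Bianchi.mem_Gamma1]
  refine ⟨?_, ?_⟩
  · show (!![(1 : 𝓞 F), a; 0, 1] : Matrix (Fin 2) (Fin 2) (𝓞 F)) 1 0 ∈ 𝔫
    simp
  · show (!![(1 : 𝓞 F), a; 0, 1] : Matrix (Fin 2) (Fin 2) (𝓞 F)) 1 1 - 1 ∈ 𝔫
    simp

omit [NumberField F] in
/-- The diagonal matrix `diag(ε, ε⁻¹)` of a unit `ε ≡ 1 (mod 𝔫)` lies in `Γ₁(𝔫)`. -/
theorem mcs_diagUnit_mem_Gamma1 {𝔫 : Ideal (𝓞 F)} {ε : (𝓞 F)ˣ} (hε : (ε : 𝓞 F) - 1 ∈ 𝔫) :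
    (⟨!![(ε : 𝓞 F), 0; 0, ((ε⁻¹ : (𝓞 F)ˣ) : 𝓞 F)], cpc_det_diagUnit ε⟩ : SL(2, 𝓞 F)) ∈ Bianchi.Gamma1 𝔫 :=
  Bianchi.Gamma_le_Gamma1 𝔫 (cpc_diagUnit_mem_Gamma hε)

/-- Hilbert modular forms of level `Γ₁(𝔫)` are `𝓞 F`-periodic on `ℍ`. -/
theorem mcs_periodic (𝔫 : Ideal (𝓞 F)) (k : (F →+* ℝ) → ℤ) (f : Point F → ℂ) (hf : f ∈ modularForms (Bianchi.Gamma1 𝔫) k)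
    (a : 𝓞 F) (z : Point F) (hz : z ∈ halfSpace F) : f (fun σ ↦ z σ + ((σ (a : F) : ℝ) : ℂ)) = f z := by
  have h := hf.transform (SL2Rel.e12 a) (mcs_e12_mem_Gamma1 𝔫 a) z hz
  obtain ⟨hmoeb, haut⟩ := kp_moeb_transl (cpc_coe_toSL2F_e12 a) k z
  rwa [hmoeb, haut, one_mul] at h

/-- **Stub P1 — `stub_modularForm_coeff_support`.** Fourier coefficients of Hilbert modular forms of level `Γ₁(𝔫)` (`𝔫 ≠ 0`,
`[F:ℚ] ≥ 2`) live on the cone: `a_μ(f) = 0` for every `μ` of the dual lattice that is neither `0` nor totally positive.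
[cite: Freitag1990, Ch. I Prop. 4.9] -/
theorem stub_modularForm_coeff_support (F : Type) [Field F] [NumberField F] [NumberField.IsTotallyReal F]
    (hd : 1 < Module.finrank ℚ F) (𝔫 : Ideal (𝓞 F)) (h𝔫 : 𝔫 ≠ ⊥) (k : (F →+* ℝ) → ℤ) (f : Point F → ℂ)
    (hf : f ∈ modularForms (Bianchi.Gamma1 𝔫) k) (μ : F) (hμ : ∀ a : 𝓞 F, ∃ n : ℤ, Algebra.trace ℚ F (μ * a) = n)
    (hμc : μ ∉ qIndexSet F) : fourierCoeff f μ = 0 := by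
  classical
  have hnot : ¬ (μ = 0 ∨ ∀ σ : F →+* ℝ, 0 < σ μ) := fun h ↦ hμc ⟨hμ, h⟩
  have hμ0 : μ ≠ 0 := fun h ↦ hnot (Or.inl h)
  have hμpos : ¬ ∀ σ : F →+* ℝ, 0 < σ μ := fun h ↦ hnot (Or.inr h)
  -- the multipliers of the congruence units
  set d : (𝓞 F)ˣ → ℂ := fun ε ↦ ∏ σ : F →+* ℝ, ((σ (((ε⁻¹ : (𝓞 F)ˣ) : 𝓞 F) : F) : ℝ) : ℂ) ^ k σ with hddef
  have hd_ne : ∀ ε, d ε ≠ 0 := by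
    intro ε
    refine Finset.prod_ne_zero_iff.2 fun σ _ ↦ zpow_ne_zero _ ?_
    have hε : (((ε⁻¹ : (𝓞 F)ˣ) : 𝓞 F) : F) ≠ 0 := mt RingOfIntegers.coe_eq_zero_iff.mp (Units.ne_zero _)
    exact_mod_cast (map_ne_zero σ).2 hε
  have hunit : ∀ ε : (𝓞 F)ˣ, (ε : 𝓞 F) - 1 ∈ 𝔫 → ∀ z ∈ halfSpace F,
      f (fun σ ↦ ((σ ((ε : 𝓞 F) : F) : ℝ) : ℂ) ^ 2 * z σ) = d ε * f z := by
    intro ε hε z hz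
    have h := hf.transform _ (mcs_diagUnit_mem_Gamma1 hε) z hz
    obtain ⟨hmoeb, haut⟩ := kp_moeb_diag (cpc_coe_toSL2F_diagUnit ε) k z
    rwa [hmoeb, haut] at h
  obtain ⟨U, hU, hUsq⟩ := stub_unitCongruence_sq_finiteIndex F 𝔫 h𝔫
  set c : (𝓞 F)ˣ → ℂ := fun η ↦
    if hη : ∃ ε : (𝓞 F)ˣ, (ε : 𝓞 F) - 1 ∈ 𝔫 ∧ η = ε ^ 2 then d hη.choose else 1 with hcdef
  have hc : ∀ η ∈ U, c η ≠ 0 := by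
    intro η _
    simp only [hcdef]
    split_ifs with hη
    · exact hd_ne _
    · exact one_ne_zero
  have hmod : ∀ η ∈ U, (∀ σ : F →+* ℝ, 0 < σ ((η : 𝓞 F) : F)) → ∀ z : Point F, (∀ σ, 0 < (z σ).im) →
      f (fun σ ↦ ((σ ((η : 𝓞 F) : F) : ℝ) : ℂ) * z σ) = c η * f z := by
    intro η hη _ z hz
    have hex : ∃ ε : (𝓞 F)ˣ, (ε : 𝓞 F) - 1 ∈ 𝔫 ∧ η = ε ^ 2 := hUsq η hη
    have hcη : c η = d hex.choose := by simp only [hcdef, dif_pos hex]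
    obtain ⟨hε1, hηε⟩ := hex.choose_spec
    have hval : ((η : 𝓞 F) : F) = ((hex.choose : 𝓞 F) : F) ^ 2 := by
      have hc2 := congrArg (fun u : (𝓞 F)ˣ ↦ ((u : 𝓞 F) : F)) hηε
      simpa [Units.val_pow_eq_pow_val] using hc2
    have key := hunit hex.choose hε1 z hz
    rw [hcη]
    convert key using 2
    funext σ
    rw [hval, map_pow]
    push_cast
    ring
  exact koecher_fourierCoeff_eq_zero F hd f hf.holomorphic (fun a z hz ↦ mcs_periodic 𝔫 k f hf a z hz) U hU c hc hmod μ hμ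
    hμ0 hμpos

end Summit.Langlands.Langlands.Theorems.HilbertIntegralOverconvergentIsCongruence
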